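import Summits.QuantumFields.YangMills.Theorems.BalabanUVNodesN15TwoSpacingGluingCurvedKnitObjects
import Summits.QuantumFields.YangMills.Theorems.BalabanUVNodesN15TwoSpacingGluingNeumannKnitRightNonlocal
import HarnessLib

/-!
# THE GLUING STEP AT TWO LATTICE SPACINGS — (Γ15b) THE LIVE-`U` KNIT AT THE COVER, TWO GRIDS, I: THE COVER's TWO-GRID ROWS ON dag-n15-w3's COLOURED CARRIER — the cut-box
# defects `𝔇(M_{χ′_k}N′_k, M_{χ_k}N_k)`, `𝔇(M_{χ′_k}∇̂′N′_k, M_{χ_k}∇̂N_k)`, `𝔇(M_{χ′_k}∇̂⁻′N′_k, M_{χ_k}∇̂⁻N_k)` (53's `hDcut`∕`hDcutF`∕`hDcutB`), the commutator defect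
# `𝔇([N′_L, M_{h′_k}], [N_L, M_{h_k}])` (`hDKN`), the tail defect (`hDT`), and the lifted partition fits — transport lemmas through the inner cut, the colour lift `⊗ 1_ι` and King's pairing
# `liftMap (kingPrV …) ι` (dag-n15-c g15, FILE 121; N15 = NE2, s1 «background-layer OPERATOR ingredient»)

Cell `pub-ymgap`, seat `pub-ymgap-dag-n15-c` (R134 (a); HUMAN RULING D-0062), generation 15.  `bears_on: R4∕N15 · K3⁸ SpineGivenEndpointR13SepCoPHV (stmt-QuantumFields-27366)`.
Filed `--kind proof --supports stmt-QuantumFields-27366 --as helper` — COUNT-NEUTRAL.  Theorems only; 0 `def`, 0 `sorry`.  Imports BY NAME FILE 119 `…CurvedKnitObjects` (through it 117∕118,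
FILES 56∕66∕67∕69∕72, dag-n15-a N-II (`tail_tensorId_eq`, `hasMaj_idef_tail_tensorId_neumannCubeG_of`, `pull_kingPrV_comp_mulOp_chiCube`, `blkFine_comp_kingPrV`, `idef_tensorId`),
dag-n15-w4 VI∕VII).  Nothing in the tree is modified, no landed name re-declared.

WHY.  dag-n15-w3 53 `uN_hasMaj_idef_glueInv_smoothCutDressed_localGauges` (the two-grid η-defect capstone) displays, beyond 52's one-grid rows at both spacings, the two-grid DEFECT rows
of the flat cubes cut to the input box (`hDcut hDcutF hDcutB`, target norm `liftBlk blk ι ∘ liftMap π ι`), of the commutator of the flat nonlocal part with the partition (`hDKN`, target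
`liftBlk (blk ∘ π) ι`), of the tail (`hDT`) and the two-grid fits of the partition's quotients (`hf1 hf1b hf2 hfh`).  THIS FILE supplies the transports that turn dag-n15-a's scalar
cube-defect families (N-IIc∕N-IIe∕N-IIh: cut = the cube's own indicator) and FILE 56's commutator defect into those literal shapes at FILE 70's cover with FILE 117's inner cut box.
* §1 `idef_cut_comp` (`𝔇(M_{χ′}A′, M_χA) = M_{χ′}∘𝔇(A′, A)` when `P∘M_χ = M_{χ′}∘P`), `hasMaj_idef_tensorId` (the lift keeps a defect majorant), `hasMaj_tgt_congr` ∕ `hasMaj_src_tgt_congr`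
  (block-map transport), `blkCover_comp_kingPrV`, `abs_fgrad_lift_pair_eq` ∕ `abs_bgrad_lift_pair_eq` ∕ `abs_fgradAdj_fgrad_lift_pair_eq` (the lifted fits read on the first factor).
* §2 ★★ `hasMaj_idef_cut_cover_lift` ∕ ★★ `hasMaj_idef_cutF_cover_lift` ∕ ★★ `hasMaj_idef_cutB_cover_lift` — 53's `hDcut`∕`hDcutF`∕`hDcutB` at the cover from the scalar cube-cut defect
  rows (displayed; dag-n15-a N-IIc∕e∕h plug in FILE 122), inner cut via `idef_cut_comp` + `chiCube_inner_cut`.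
* §3 ★★ `hasMaj_idef_commOp_nonlocal_cover_lift` — 53's `hDKN` (FILE 56 with FILE 67's Lipschitz∕oscillation `π(d+1)∕w` and h-fit `π(d+1)∕(L^k w)`, lifted).
* §4 ★★★ `hasMaj_idef_tail_cover_lift` — 53's `hDT` (dag-n15-a `hasMaj_idef_tail_tensorId_neumannCubeG_of` at FILE 117's `H`, inner box `A`, gap `w`, bump fit dag-n15-w4 VI, h-fit FILE 67).

HONEST FRAMING ∕ LIMITS.  Transport ∕ componentwise-lift bookkeeping over LANDED rows; no new analytic estimate; `U ≡ 1` doubled-cube torus MODEL cubes; nothing of [B5]∕[B6]∕[B9]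
asserted ((2.36)–(2.37) p.229, (2.92)–(2.93) p.239, (2.133)–(2.136) p.247, (2.156) p.250; Thm 3.14 pp.426–427 = difference TEMPLATE).  NE2⁺ NOT PRINTED, NOT proved; N15 NOT
discharged; K3⁸ OPEN, skeleton v6 untouched; counts of record UNMOVED (typed 28∕28 · discharged 5∕27); one finite 𝕋⁴ at fixed ε — NOT infinite volume, NOT OS on ℝ⁴, NOT a
mass gap, NOT Clay; R4 closes the conditional finite-𝕋⁴ rung `BalabanLadder.UV` only.  Restate-immune (no Theses import).
-/

noncomputable section

namespace Summit.QuantumFields.YangMills.BalabanUVNodes.N15.Gluing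

open Real
open Literature.MathematicalPhysics.QuantumFieldTheory.Balaban1983to89
open Literature.MathematicalPhysics.QuantumFieldTheory.Balaban1983to89.B5Prop11Plancherel (Tor fine unitVec)
open Literature.MathematicalPhysics.QuantumFieldTheory.Balaban1983to89.B11SectG (BlockNorm HasMaj RowSum)
open Literature.MathematicalPhysics.QuantumFieldTheory.Balaban1983to89.T4EtaRateDefect (idef idef_comp)
open Literature.MathematicalPhysics.QuantumFieldTheory.Balaban1983to89.T4EtaRateCoeffDefect (pull pull_apply)
open Literature.MathematicalPhysics.QuantumFieldTheory.Balaban1983to89.B6RandomWalk (Triangle254)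
open Literature.MathematicalPhysics.QuantumFieldTheory.Balaban1983to89.B6Prop26Gluing (mulOp mulOp_apply ind ind_nonneg ind_le_one)
open Literature.MathematicalPhysics.QuantumFieldTheory.Balaban1983to89.B6UnitTorusCarrier (unitTorusGeo unitTorusGeo_dist_nonneg unitTorusGeo_dist_symm)
open Literature.MathematicalPhysics.QuantumFieldTheory.King1986.Torus (blockOf tdistT tdistT_nonneg)
open Summit.QuantumFields.YangMills.BalabanUVNodes.N15.BackgroundLayer (fgrad fgradAdj bgrad fgrad_apply fgradAdj_apply bgrad_apply fgrad_liftEquiv_comp bgrad_liftEquiv_comp)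
open Summit.QuantumFields.YangMills.BalabanUVNodes.N15.VectorPiece (bshiftEquiv kingPrV tensorId tensorId_apply hasMaj_tensorId idef_tensorId blkFine_comp_kingPrV)
open Summit.QuantumFields.YangMills.BalabanUVNodes.N15.MatrixSpecies (liftBlk liftMap liftEquiv liftEquiv_apply liftEquiv_symm_apply)
open Summit.QuantumFields.YangMills.BalabanUVNodes.N15.TwoGrid (symbOp sD landauRe qvRe qvAdjRe gOp neumannCubeG chiCube cubeBlocks tensorId_mulOp mulOp_fst_comp_tensorId tensorId_comp_mulOp_fst
  tail_tensorId_eq hasMaj_idef_tail_tensorId_neumannCubeG_of pull_kingPrV_comp_mulOp_chiCube hasMaj_mulOp_comp_of_abs_le_one abs_chiCube_le_one)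

variable {d : ℕ}

/-! ## §1 Transport lemmas -/

section Transport

variable {X X' : Type} (ι : Type)

omit ι in
/-- ★ `𝔇(M_{χ′}∘A′, M_χ∘A) = M_{χ′}∘𝔇(A′, A)` whenever the cut is read through the pairing, `P∘M_χ = M_{χ′}∘P`. [folklore] -/
theorem idef_cut_comp {F F' : Type} [AddCommGroup F] [Module ℝ F] [AddCommGroup F'] [Module ℝ F'] (τ : F →ₗ[ℝ] F') (pr : X' → X) {χ : X → ℝ} {χ' : X' → ℝ}
    (hχ : pull pr ∘ₗ mulOp χ = mulOp χ' ∘ₗ pull pr) (A' : F' →ₗ[ℝ] (X' → ℝ)) (A : F →ₗ[ℝ] (X → ℝ)) :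
    idef τ (pull pr) (mulOp χ' ∘ₗ A') (mulOp χ ∘ₗ A) = mulOp χ' ∘ₗ idef τ (pull pr) A' A := by
  have h0 : idef (pull pr) (pull pr) (mulOp χ') (mulOp χ) = 0 := by rw [idef, hχ, sub_self]
  rw [idef_comp τ (pull pr) (pull pr), h0, LinearMap.zero_comp, add_zero]

variable [Fintype X] [Fintype X'] [Fintype ι] {g : B6.Geometry}

/-- ★ **THE LIFT KEEPS A DEFECT MAJORANT**: `𝔇(T′, T) ≤ K` (`K ≥ 0`) between block norms `blk`, `blk₂` ⟹ `𝔇(T′ ⊗ 1, T ⊗ 1) ≤ K` through the lifted pairings, between `liftBlk blk ι`, `liftBlk blk₂ ι`. [folklore] -/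
theorem hasMaj_idef_tensorId {blk : X → g.Site} {blk₂ : X' → g.Site} (pr : X' → X) {T' : (X' → ℝ) →ₗ[ℝ] (X' → ℝ)} {T : (X → ℝ) →ₗ[ℝ] (X → ℝ)} {K : g.Site → g.Site → ℝ}
    (hK : ∀ y y', 0 ≤ K y y') (h : HasMaj (BlockNorm.ofBlocks g blk) (BlockNorm.ofBlocks g blk₂) (idef (pull pr) (pull pr) T' T) K) :
    HasMaj (BlockNorm.ofBlocks g (liftBlk blk ι)) (BlockNorm.ofBlocks g (liftBlk blk₂ ι)) (idef (pull (liftMap pr ι)) (pull (liftMap pr ι)) (tensorId ι T') (tensorId ι T)) K := by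
  rw [idef_tensorId]
  exact hasMaj_tensorId ι hK h

omit [Fintype ι] in
/-- transport of a majorant along an equality of target block maps. [folklore] -/
theorem hasMaj_tgt_congr {F₁ : Type} [AddCommGroup F₁] [Module ℝ F₁] {b₁ : BlockNorm g F₁} {f f' : X' → g.Site} (hf : f = f') {T : F₁ →ₗ[ℝ] (X' → ℝ)} {K : g.Site → g.Site → ℝ}
    (h : HasMaj b₁ (BlockNorm.ofBlocks g f) T K) : HasMaj b₁ (BlockNorm.ofBlocks g f') T K := by
  subst hf; exact h

omit [Fintype ι] in
/-- transport of a majorant along an equality of block maps on both sides. [folklore] -/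
theorem hasMaj_src_tgt_congr {f f' : X' → g.Site} (hf : f = f') {T : (X' → ℝ) →ₗ[ℝ] (X' → ℝ)} {K : g.Site → g.Site → ℝ}
    (h : HasMaj (BlockNorm.ofBlocks g f) (BlockNorm.ofBlocks g f) T K) : HasMaj (BlockNorm.ofBlocks g f') (BlockNorm.ofBlocks g f') T K := by
  subst hf; exact h

omit [Fintype X] [Fintype X'] [Fintype ι] in
/-- the lifted fit of forward quotients is read on the first factor. [folklore] -/
theorem abs_fgrad_lift_pair_eq (pr : X' → X) (c c' : ℝ) (s : X ≃ X) (s' : X' ≃ X') (h : X → ℝ) (h' : X' → ℝ) (p' : X' × ι) :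
    |fgrad c' (liftEquiv s' ι) (fun p : X' × ι => h' p.1) p' - fgrad c (liftEquiv s ι) (fun p : X × ι => h p.1) (liftMap pr ι p')| = |fgrad c' s' h' p'.1 - fgrad c s h (pr p'.1)| := by
  simp only [fgrad_apply, liftEquiv_apply, liftMap]

omit [Fintype X] [Fintype X'] [Fintype ι] in
/-- the lifted fit of backward quotients is read on the first factor. [folklore] -/
theorem abs_bgrad_lift_pair_eq (pr : X' → X) (c c' : ℝ) (s : X ≃ X) (s' : X' ≃ X') (h : X → ℝ) (h' : X' → ℝ) (p' : X' × ι) :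
    |bgrad c' (liftEquiv s' ι) (fun p : X' × ι => h' p.1) p' - bgrad c (liftEquiv s ι) (fun p : X × ι => h p.1) (liftMap pr ι p')| = |bgrad c' s' h' p'.1 - bgrad c s h (pr p'.1)| := by
  simp only [bgrad_apply, liftEquiv_symm_apply, liftMap]

omit [Fintype X] [Fintype X'] [Fintype ι] in
/-- the lifted fit of the directional Laplacians is read on the first factor. [folklore] -/
theorem abs_fgradAdj_fgrad_lift_pair_eq (pr : X' → X) (c c' : ℝ) (s : X ≃ X) (s' : X' ≃ X') (h : X → ℝ) (h' : X' → ℝ) (p' : X' × ι) :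
    |fgradAdj c' (liftEquiv s' ι) (fgrad c' (liftEquiv s' ι) (fun p : X' × ι => h' p.1)) p' - fgradAdj c (liftEquiv s ι) (fgrad c (liftEquiv s ι) (fun p : X × ι => h p.1)) (liftMap pr ι p')| =
      |fgradAdj c' s' (fgrad c' s' h') p'.1 - fgradAdj c s (fgrad c s h) (pr p'.1)| := by
  simp only [fgradAdj_apply, fgrad_apply, liftEquiv_apply, liftEquiv_symm_apply, liftMap]

end Transport

section Cover

variable {M : Fin (d + 1) → ℕ} [∀ μ, NeZero (M μ)] {L kk r w q m₀ m₁ S₁ : ℕ} [NeZero L] (ι : Type) [Fintype ι]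

omit [Fintype ι] in
/-- the cover's coarse block map read through King's pairing IS the fine block map, on the coloured carrier. [cite: King1986, p.664 (pairing convention «x′ ∈ B^n(x)»)] -/
theorem liftBlk_blkCover_comp_liftMap :
    liftBlk (fun b : Tor (fine (L ^ kk) M) × Fin (d + 1) => blockOf (L ^ kk) M b.1) ι ∘ liftMap (kingPrV L kk r M) ι =
      liftBlk (fun b' : Tor (fine (L ^ r * L ^ kk) M) × Fin (d + 1) => blockOf (L ^ r * L ^ kk) M b'.1) ι := by
  funext p'
  exact congrFun (blkFine_comp_kingPrV (M := M) L kk r) p'.1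

omit [Fintype ι] in
/-- the same identity in the `liftBlk (blk ∘ π) ι` spelling. [folklore] -/
theorem liftBlk_blkCover_comp_kingPrV :
    liftBlk ((fun b : Tor (fine (L ^ kk) M) × Fin (d + 1) => blockOf (L ^ kk) M b.1) ∘ kingPrV L kk r M) ι =
      liftBlk (fun b' : Tor (fine (L ^ r * L ^ kk) M) × Fin (d + 1) => blockOf (L ^ r * L ^ kk) M b'.1) ι := by
  funext p'
  exact congrFun (blkFine_comp_kingPrV (M := M) L kk r) p'.1

/-! ## §2 The cut-box two-grid defects of the flat cubes (53's `hDcut`∕`hDcutF`∕`hDcutB`) -/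

/-- ★★ **53's `hDcut` AT THE COVER** from the scalar cube-cut defect row `𝔇(M_{χ_{□}′}G′(□), M_{χ_□}G(□)) ≤ K` (dag-n15-a N-IIc, displayed): the same majorant for the INNER cut box
`c(m₁,k) + [0,S₁)` (`m₁ ≤ m₀`, `(m₀ − m₁) + S₁ ≤ qw`) on the coloured carrier, target blocks read through the lifted pairing. [cite: Balaban1985BackgroundPropagators, Thm 3.14 pp.426–427 (difference template); Balaban1984PropagatorsII, (2.37) p.229, (2.133) p.247] -/
theorem hasMaj_idef_cut_cover_lift (hM : ∀ ν, M ν = 2 * q * w) (hm : m₁ ≤ m₀) (hfit : (m₀ - m₁) + S₁ ≤ q * w) (hS₀ : q * w ≤ 2 * q * w) (k : Fin (d + 1) → ZMod (2 * q))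
    {G : (Tor (fine (L ^ kk) M) × Fin (d + 1) → ℝ) →ₗ[ℝ] (Tor (fine (L ^ kk) M) × Fin (d + 1) → ℝ)}
    {G' : (Tor (fine (L ^ r * L ^ kk) M) × Fin (d + 1) → ℝ) →ₗ[ℝ] (Tor (fine (L ^ r * L ^ kk) M) × Fin (d + 1) → ℝ)} {K : Tor M → Tor M → ℝ} (hK : ∀ y y', 0 ≤ K y y')
    (hD : HasMaj (BlockNorm.ofBlocks (unitTorusGeo L kk M) (fun b : Tor (fine (L ^ kk) M) × Fin (d + 1) => blockOf (L ^ kk) M b.1))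
      (BlockNorm.ofBlocks (unitTorusGeo L kk M) (fun b' : Tor (fine (L ^ r * L ^ kk) M) × Fin (d + 1) => blockOf (L ^ r * L ^ kk) M b'.1))
      (idef (pull (kingPrV L kk r M)) (pull (kingPrV L kk r M)) (mulOp (chiCube M (L ^ r * L ^ kk) (coverCorner M w q m₀ k) (q * w)) ∘ₗ G')
        (mulOp (chiCube M (L ^ kk) (coverCorner M w q m₀ k) (q * w)) ∘ₗ G)) K) :
    HasMaj (BlockNorm.ofBlocks (unitTorusGeo L kk M) (liftBlk (fun b : Tor (fine (L ^ kk) M) × Fin (d + 1) => blockOf (L ^ kk) M b.1) ι))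
      (BlockNorm.ofBlocks (unitTorusGeo L kk M) (liftBlk (fun b : Tor (fine (L ^ kk) M) × Fin (d + 1) => blockOf (L ^ kk) M b.1) ι ∘ liftMap (kingPrV L kk r M) ι))
      (idef (pull (liftMap (kingPrV L kk r M) ι)) (pull (liftMap (kingPrV L kk r M) ι))
        (mulOp (fun p : (Tor (fine (L ^ r * L ^ kk) M) × Fin (d + 1)) × ι => chiCube M (L ^ r * L ^ kk) (coverCorner M w q m₁ k) S₁ p.1) ∘ₗ tensorId ι G')
        (mulOp (fun p : (Tor (fine (L ^ kk) M) × Fin (d + 1)) × ι => chiCube M (L ^ kk) (coverCorner M w q m₁ k) S₁ p.1) ∘ₗ tensorId ι G)) K := by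
  -- inner cut = inner cut ∘ cube cut, both spacings; the inner cut commutes with the pairing
  have e0 : mulOp (chiCube M (L ^ kk) (coverCorner M w q m₁ k) S₁) ∘ₗ G =
      mulOp (chiCube M (L ^ kk) (coverCorner M w q m₁ k) S₁) ∘ₗ (mulOp (chiCube M (L ^ kk) (coverCorner M w q m₀ k) (q * w)) ∘ₗ G) := by
    rw [← LinearMap.comp_assoc, chiCube_inner_cut hM hm hfit hS₀ k]
  have e0' : mulOp (chiCube M (L ^ r * L ^ kk) (coverCorner M w q m₁ k) S₁) ∘ₗ G' =
      mulOp (chiCube M (L ^ r * L ^ kk) (coverCorner M w q m₁ k) S₁) ∘ₗ (mulOp (chiCube M (L ^ r * L ^ kk) (coverCorner M w q m₀ k) (q * w)) ∘ₗ G') := by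
    rw [← LinearMap.comp_assoc, chiCube_inner_cut hM hm hfit hS₀ k]
  have hsc : HasMaj (BlockNorm.ofBlocks (unitTorusGeo L kk M) (fun b : Tor (fine (L ^ kk) M) × Fin (d + 1) => blockOf (L ^ kk) M b.1))
      (BlockNorm.ofBlocks (unitTorusGeo L kk M) (fun b' : Tor (fine (L ^ r * L ^ kk) M) × Fin (d + 1) => blockOf (L ^ r * L ^ kk) M b'.1))
      (idef (pull (kingPrV L kk r M)) (pull (kingPrV L kk r M)) (mulOp (chiCube M (L ^ r * L ^ kk) (coverCorner M w q m₁ k) S₁) ∘ₗ G')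
        (mulOp (chiCube M (L ^ kk) (coverCorner M w q m₁ k) S₁) ∘ₗ G)) K := by
    rw [e0, e0', idef_cut_comp (pull (kingPrV L kk r M)) (kingPrV L kk r M) (pull_kingPrV_comp_mulOp_chiCube L kk r (coverCorner M w q m₁ k) S₁)]
    exact hasMaj_mulOp_comp_of_abs_le_one _ (fun x => abs_chiCube_le_one S₁ x) hK hD
  have h := hasMaj_idef_tensorId ι (kingPrV L kk r M) hK hsc
  rw [← mulOp_fst_comp_tensorId, ← mulOp_fst_comp_tensorId, ← liftBlk_blkCover_comp_liftMap] at h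
  exact h

/-- ★★ **53's `hDcutF` AT THE COVER** from the scalar forward-gradient cube-cut defect row (dag-n15-a N-IIe in `fgrad` currency, displayed), inner cut, lifted; any weights `c, c′`.
[cite: Balaban1985BackgroundPropagators, Thm 3.14 pp.426–427 (template); Balaban1984PropagatorsII, (2.133) p.247] -/
theorem hasMaj_idef_cutF_cover_lift (hM : ∀ ν, M ν = 2 * q * w) (hm : m₁ ≤ m₀) (hfit : (m₀ - m₁) + S₁ ≤ q * w) (hS₀ : q * w ≤ 2 * q * w) (k : Fin (d + 1) → ZMod (2 * q))
    (c c' : ℝ) (μ : Fin (d + 1)) {G : (Tor (fine (L ^ kk) M) × Fin (d + 1) → ℝ) →ₗ[ℝ] (Tor (fine (L ^ kk) M) × Fin (d + 1) → ℝ)}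
    {G' : (Tor (fine (L ^ r * L ^ kk) M) × Fin (d + 1) → ℝ) →ₗ[ℝ] (Tor (fine (L ^ r * L ^ kk) M) × Fin (d + 1) → ℝ)} {K : Tor M → Tor M → ℝ} (hK : ∀ y y', 0 ≤ K y y')
    (hD : HasMaj (BlockNorm.ofBlocks (unitTorusGeo L kk M) (fun b : Tor (fine (L ^ kk) M) × Fin (d + 1) => blockOf (L ^ kk) M b.1))
      (BlockNorm.ofBlocks (unitTorusGeo L kk M) (fun b' : Tor (fine (L ^ r * L ^ kk) M) × Fin (d + 1) => blockOf (L ^ r * L ^ kk) M b'.1))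
      (idef (pull (kingPrV L kk r M)) (pull (kingPrV L kk r M))
        (mulOp (chiCube M (L ^ r * L ^ kk) (coverCorner M w q m₀ k) (q * w)) ∘ₗ (fgrad c' (bshiftEquiv M (L ^ r * L ^ kk) μ) ∘ₗ G'))
        (mulOp (chiCube M (L ^ kk) (coverCorner M w q m₀ k) (q * w)) ∘ₗ (fgrad c (bshiftEquiv M (L ^ kk) μ) ∘ₗ G))) K) :
    HasMaj (BlockNorm.ofBlocks (unitTorusGeo L kk M) (liftBlk (fun b : Tor (fine (L ^ kk) M) × Fin (d + 1) => blockOf (L ^ kk) M b.1) ι))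
      (BlockNorm.ofBlocks (unitTorusGeo L kk M) (liftBlk (fun b : Tor (fine (L ^ kk) M) × Fin (d + 1) => blockOf (L ^ kk) M b.1) ι ∘ liftMap (kingPrV L kk r M) ι))
      (idef (pull (liftMap (kingPrV L kk r M) ι)) (pull (liftMap (kingPrV L kk r M) ι))
        (mulOp (fun p : (Tor (fine (L ^ r * L ^ kk) M) × Fin (d + 1)) × ι => chiCube M (L ^ r * L ^ kk) (coverCorner M w q m₁ k) S₁ p.1) ∘ₗ
          (fgrad c' (liftEquiv (bshiftEquiv M (L ^ r * L ^ kk) μ) ι) ∘ₗ tensorId ι G'))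
        (mulOp (fun p : (Tor (fine (L ^ kk) M) × Fin (d + 1)) × ι => chiCube M (L ^ kk) (coverCorner M w q m₁ k) S₁ p.1) ∘ₗ
          (fgrad c (liftEquiv (bshiftEquiv M (L ^ kk) μ) ι) ∘ₗ tensorId ι G))) K := by
  rw [fgrad_liftEquiv_comp, fgrad_liftEquiv_comp]
  exact hasMaj_idef_cut_cover_lift ι hM hm hfit hS₀ k hK hD

/-- ★★ **53's `hDcutB` AT THE COVER** from the scalar backward-gradient cube-cut defect row (dag-n15-a N-IIh in `bgrad` currency, displayed), inner cut, lifted.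
[cite: Balaban1985BackgroundPropagators, Thm 3.14 pp.426–427 (template); Balaban1984PropagatorsII, (2.133) p.247] -/
theorem hasMaj_idef_cutB_cover_lift (hM : ∀ ν, M ν = 2 * q * w) (hm : m₁ ≤ m₀) (hfit : (m₀ - m₁) + S₁ ≤ q * w) (hS₀ : q * w ≤ 2 * q * w) (k : Fin (d + 1) → ZMod (2 * q))
    (c c' : ℝ) (μ : Fin (d + 1)) {G : (Tor (fine (L ^ kk) M) × Fin (d + 1) → ℝ) →ₗ[ℝ] (Tor (fine (L ^ kk) M) × Fin (d + 1) → ℝ)}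
    {G' : (Tor (fine (L ^ r * L ^ kk) M) × Fin (d + 1) → ℝ) →ₗ[ℝ] (Tor (fine (L ^ r * L ^ kk) M) × Fin (d + 1) → ℝ)} {K : Tor M → Tor M → ℝ} (hK : ∀ y y', 0 ≤ K y y')
    (hD : HasMaj (BlockNorm.ofBlocks (unitTorusGeo L kk M) (fun b : Tor (fine (L ^ kk) M) × Fin (d + 1) => blockOf (L ^ kk) M b.1))
      (BlockNorm.ofBlocks (unitTorusGeo L kk M) (fun b' : Tor (fine (L ^ r * L ^ kk) M) × Fin (d + 1) => blockOf (L ^ r * L ^ kk) M b'.1))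
      (idef (pull (kingPrV L kk r M)) (pull (kingPrV L kk r M))
        (mulOp (chiCube M (L ^ r * L ^ kk) (coverCorner M w q m₀ k) (q * w)) ∘ₗ (bgrad c' (bshiftEquiv M (L ^ r * L ^ kk) μ) ∘ₗ G'))
        (mulOp (chiCube M (L ^ kk) (coverCorner M w q m₀ k) (q * w)) ∘ₗ (bgrad c (bshiftEquiv M (L ^ kk) μ) ∘ₗ G))) K) :
    HasMaj (BlockNorm.ofBlocks (unitTorusGeo L kk M) (liftBlk (fun b : Tor (fine (L ^ kk) M) × Fin (d + 1) => blockOf (L ^ kk) M b.1) ι))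
      (BlockNorm.ofBlocks (unitTorusGeo L kk M) (liftBlk (fun b : Tor (fine (L ^ kk) M) × Fin (d + 1) => blockOf (L ^ kk) M b.1) ι ∘ liftMap (kingPrV L kk r M) ι))
      (idef (pull (liftMap (kingPrV L kk r M) ι)) (pull (liftMap (kingPrV L kk r M) ι))
        (mulOp (fun p : (Tor (fine (L ^ r * L ^ kk) M) × Fin (d + 1)) × ι => chiCube M (L ^ r * L ^ kk) (coverCorner M w q m₁ k) S₁ p.1) ∘ₗ
          (bgrad c' (liftEquiv (bshiftEquiv M (L ^ r * L ^ kk) μ) ι) ∘ₗ tensorId ι G'))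
        (mulOp (fun p : (Tor (fine (L ^ kk) M) × Fin (d + 1)) × ι => chiCube M (L ^ kk) (coverCorner M w q m₁ k) S₁ p.1) ∘ₗ
          (bgrad c (liftEquiv (bshiftEquiv M (L ^ kk) μ) ι) ∘ₗ tensorId ι G))) K := by
  rw [bgrad_liftEquiv_comp, bgrad_liftEquiv_comp]
  exact hasMaj_idef_cut_cover_lift ι hM hm hfit hS₀ k hK hD

/-! ## §3 The commutator defect of the flat nonlocal part against the partition (53's `hDKN`) -/

/-- ★★ **53's `hDKN` AT THE COVER**: `𝔇([N′_L ⊗ 1, M_{h′_k∘fst}], [N_L ⊗ 1, M_{h_k∘fst}]) ≤ ((π(d+1)∕w·(eε)⁻¹ + 2π(d+1)∕w)r_N + 2·(π(d+1)∕(L^k w))·c_N)·e^{−(δ_N−ε)d}` — FILE 56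
`hasMaj_idef_commOp_nonlocal` with the cover's Lipschitz∕oscillation letters (FILE 67) and h-fit (FILE 67 `abs_coverH_fine_sub_le`), the scalar letters of `N_L`, `N′_L`, `𝔇(N′_L, N_L)` displayed, lifted.
[cite: Balaban1984PropagatorsI, (1.126)–(1.128) p.38 (shapes); Balaban1985BackgroundPropagators, Thm 3.14 pp.426–427 (template)] -/
theorem hasMaj_idef_commOp_nonlocal_cover_lift (hM : ∀ ν, M ν = 2 * q * w) (hw : 0 < w) (k : Fin (d + 1) → ZMod (2 * q))
    {NL : (Tor (fine (L ^ kk) M) × Fin (d + 1) → ℝ) →ₗ[ℝ] (Tor (fine (L ^ kk) M) × Fin (d + 1) → ℝ)}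
    {NL' : (Tor (fine (L ^ r * L ^ kk) M) × Fin (d + 1) → ℝ) →ₗ[ℝ] (Tor (fine (L ^ r * L ^ kk) M) × Fin (d + 1) → ℝ)} {cN rN δN ε : ℝ} (hcN : 0 ≤ cN) (hrN : 0 ≤ rN) (hε : 0 < ε)
    (hN : HasMaj (BlockNorm.ofBlocks (unitTorusGeo L kk M) (fun b : Tor (fine (L ^ kk) M) × Fin (d + 1) => blockOf (L ^ kk) M b.1))
      (BlockNorm.ofBlocks (unitTorusGeo L kk M) (fun b : Tor (fine (L ^ kk) M) × Fin (d + 1) => blockOf (L ^ kk) M b.1)) NL (fun y y' => cN * Real.exp (-(δN * tdistT M y y'))))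
    (hN' : HasMaj (BlockNorm.ofBlocks (unitTorusGeo L kk M) ((fun b : Tor (fine (L ^ kk) M) × Fin (d + 1) => blockOf (L ^ kk) M b.1) ∘ kingPrV L kk r M))
      (BlockNorm.ofBlocks (unitTorusGeo L kk M) ((fun b : Tor (fine (L ^ kk) M) × Fin (d + 1) => blockOf (L ^ kk) M b.1) ∘ kingPrV L kk r M)) NL' (fun y y' => cN * Real.exp (-(δN * tdistT M y y'))))
    (hDN : HasMaj (BlockNorm.ofBlocks (unitTorusGeo L kk M) (fun b : Tor (fine (L ^ kk) M) × Fin (d + 1) => blockOf (L ^ kk) M b.1))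
      (BlockNorm.ofBlocks (unitTorusGeo L kk M) ((fun b : Tor (fine (L ^ kk) M) × Fin (d + 1) => blockOf (L ^ kk) M b.1) ∘ kingPrV L kk r M))
      (idef (pull (kingPrV L kk r M)) (pull (kingPrV L kk r M)) NL' NL) (fun y y' => rN * Real.exp (-(δN * tdistT M y y')))) :
    HasMaj (BlockNorm.ofBlocks (unitTorusGeo L kk M) (liftBlk (fun b : Tor (fine (L ^ kk) M) × Fin (d + 1) => blockOf (L ^ kk) M b.1) ι))
      (BlockNorm.ofBlocks (unitTorusGeo L kk M) (liftBlk ((fun b : Tor (fine (L ^ kk) M) × Fin (d + 1) => blockOf (L ^ kk) M b.1) ∘ kingPrV L kk r M) ι))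
      (idef (pull (liftMap (kingPrV L kk r M) ι)) (pull (liftMap (kingPrV L kk r M) ι))
        (commOp (tensorId ι NL') (fun p : (Tor (fine (L ^ r * L ^ kk) M) × Fin (d + 1)) × ι => hcube (2 * q) (coverXi M (L ^ r * L ^ kk) w) k p.1))
        (commOp (tensorId ι NL) (fun p : (Tor (fine (L ^ kk) M) × Fin (d + 1)) × ι => hcube (2 * q) (coverXi M (L ^ kk) w) k p.1)))
      (fun y y' => ((π * (d + 1) / w * (Real.exp 1 * ε)⁻¹ + 2 * (π * (d + 1) / w)) * rN + 2 * (π * (d + 1) / (((L ^ kk : ℕ) : ℝ) * w)) * cN) *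
        Real.exp (-((δN - ε) * (unitTorusGeo L kk M).dist y y'))) := by
  have hsc := hasMaj_idef_commOp_nonlocal (g := unitTorusGeo L kk M) (fun b : Tor (fine (L ^ kk) M) × Fin (d + 1) => blockOf (L ^ kk) M b.1) (kingPrV L kk r M)
    (h := hcube (2 * q) (coverXi M (L ^ kk) w) k) (h' := hcube (2 * q) (coverXi M (L ^ r * L ^ kk) w) k) (hb := coverHb M (L ^ kk) w q k)
    hcN hrN (by positivity : (0 : ℝ) ≤ π * (d + 1) / w) (by positivity : (0 : ℝ) ≤ π * (d + 1) / w) (by positivity : (0 : ℝ) ≤ π * (d + 1) / (((L ^ kk : ℕ) : ℝ) * w)) hε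
    (unitTorusGeo_dist_nonneg L kk M) (unitTorusGeo_dist_symm L kk M) (fun y y' => abs_coverHb_sub_le hM hw k y y') (fun x => abs_coverH_sub_coverHb_le hM hw k x)
    (fun x' => by have h := abs_coverH_sub_coverHb_le (M := M) (n := L ^ r * L ^ kk) hM hw k x'; rwa [coverHb_eq_of_spacing (L ^ kk) (L ^ r * L ^ kk) hw k, ← congrFun (blkFine_comp_kingPrV (M := M) L kk r) x'] at h)
    (fun x' => abs_coverH_fine_sub_le kk r hM hw k x') hN hN' hDN
  rw [commOp_tensorId_fst, commOp_tensorId_fst]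
  exact hasMaj_idef_tensorId ι (kingPrV L kk r M) (fun y y' => by positivity) hsc

end Cover

end Summit.QuantumFields.YangMills.BalabanUVNodes.N15.Gluing

end
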